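import Summits.QuantumFields.YangMills.Theorems.ColdStartUniversalityShenZhuZhuGradientFormSUN
import HarnessLib

/-!
# Shen–Zhu–Zhu's Poincaré inequality in the Literature's DERIVATIVE-FREE DIRICHLET-FORM currency `langevinDirichletForm` (metric link slopes),
# every `SU(N)`, every `d`: `K · Var_{μ_{Λ_L,Nβ}}(F) ≤ 𝓔_{Λ_L,Nβ}(F)`, `K = N/2 − 4dN|β|` — via the pointwise bound `|∇_e F|² ≤ (link slope)²`

Seat `ym-line-csu-p1` (g40), route `ColdStartUniversality` of `Summits/QuantumFields/YangMills`, helper file G34 (strong coupling; `--supports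
stmt-QuantumFields-24809`).  The Literature types SZZ's Dirichlet form `𝓔(F) = Σ_e ∫ |∇_e F|² dμ_β` (CMP 400 (2023) §3, (3.8)) WITHOUT derivatives, as
`langevinDirichletForm r β F = Σ_e ∫⁻ (linkSlope r F U e)² dμ_β` with the metric upper gradient
`linkSlope r F U e = limsup_{g → U_e, g ≠ U_e} |F(U^{e←g}) − F(U)| / ‖ρ g − ρ U_e‖_F` (`LatticeLangevinDynamics`); no theorem of the tree used it so far.
This file connects it to the Bakry–Émery package (venture `YMGap` carré du champ `Γ`, G21/G31) for every `SU(N)`, `d`: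

* §1 ★★ `ofReal_linkGam_le_linkSlope_sq` — POINTWISE, for every smooth `u` of the link matrices, every configuration `U ∈ SU(N)^{E}` and link `e`:
  `Σ_α (D_{(e,α)} u)²(U) ≤ (linkSlope (u∘emb) U e)²` — the squared Riemannian link gradient is dominated by the squared metric slope (test the `limsup`
  along the one-parameter subgroup `t ↦ e^{tZ} U_e` generated by the Riesz representer `Z ∈ 𝔰𝔲(N)` of the link differential: the difference quotient
  tends to `|du[Z U_e]|/‖Z‖_F = ‖Z‖_F`, and `‖Z‖_F² = Σ_α (D_{(e,α)}u)²` by Parseval and left/right invariance).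
* §2 ★★ `ofReal_integral_Gam_le_langevinDirichletForm` — `∫ Γ(u,u) dμ_{Λ_L,β'} ≤ 𝓔_{Λ_L,β'}(u∘emb)` (in `ℝ≥0∞`), every `β'`, `L`, `N ≥ 1`, `d`.
* §3 ★★★ `szz_poincare_dirichletForm_sun` — `ENNReal.ofReal ((N/2 − 4dN|β|) · Var_{μ_{Λ_L,Nβ}}(u∘emb)) ≤ langevinDirichletForm (fundamentalLatticeRep N) (Nβ) (u∘emb)`
  for every torus, every `SU(N)`, `d`, every smooth `u` (G31's Γ-form Poincaré + §2); ★★★ `szz_poincare_dirichletForm_printed_sun` — the same with SZZ's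
  printed `K_S = szzBakryEmeryConstSU N d β` on Assumption 1.1's window (`d ≥ 2`): Shen–Zhu–Zhu's Cor. 4.4 (4.11) in the currency of their (3.8).

THEOREMS ONLY, no definition, no sorry.  The converse pointwise bound (slope ≤ gradient, true for smooth `u`) is not needed and not proved.  HONEST
FRAMING: STRONG coupling, fixed lattice; nothing `K`-uniform along the route's scaling (`UniformColdStartMixing`, 24809, ASIDE, not restated); no crux,
rung or summit statement is proved; the Yang–Mills mass gap is NOT proved.  References: H. Shen, R. Zhu, X. Zhu, CMP 400 (2023) 805–851, §3 (3.8),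
Cor. 4.4 (4.11), §2 (2.3)–(2.4) [ShenZhuZhu2022]; J. Heinonen, *Lectures on analysis on metric spaces* (2001), §6 (upper gradients).
-/

set_option autoImplicit false

noncomputable section

namespace Summit.QuantumFields.YangMills.Theorems.ColdStartUniversality

open MeasureTheory ProbabilityTheory Finset Filter Set Function
open scoped BigOperators NNReal ENNReal Topology Matrix Matrix.Norms.Frobenius ContDiff
open Literature.MathematicalPhysics.QuantumFieldTheory
open Literature.MathematicalPhysics.QuantumLattice (fundamentalRep fundamentalLatticeRep continuous_fundamentalRep fundamentalRep_apply)
open Literature.MathematicalPhysics.QuantumFieldTheory.SUNBakryEmery (SUN FrameIdx frame frame_conjTranspose frame_trace frameGrad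
  frameGrad_conjTranspose frameGrad_trace sum_sq_apply_frame frobNorm_frameGrad_sq expSU coe_expSU)
open Summit.Ventures.YMGap.LatticeBakryEmery (PSU Cfg emb emb_apply Gam lk bframe algD algD_apply linkFun linkFun_apply Gam_self_eq_sum_linkFun
  contDiff_Gam)

variable {d N L : ℕ} [NeZero L]

/-! ## §1. Pointwise: the squared link gradient is dominated by the squared metric slope -/

omit [NeZero L] in
/-- Embedding commutes with replacing one link. [folklore] -/
theorem emb_update (U : GaugeConfig d L (SUN N)) (e : Edge d L) (g : SUN N) :
    emb (Function.update U e g) = Function.update (emb U) e (g : Matrix (Fin N) (Fin N) ℂ) := by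
  funext e'
  by_cases h : e' = e
  · subst h; simp [emb]
  · simp [emb, h]

/-- The link differential `A ↦ du(U)[single_e(A U_e)]` as a real-linear functional. Its values on the Parseval frame are the right-invariant
link derivatives; by left/right invariance their squares sum to the link part of `Γ(u,u)`. [cite: ShenZhuZhu2022, §2 (2.3)–(2.4)] -/
theorem sum_sq_algD_eq_frobNorm_frameGrad_sq (hN : N ≠ 0) {ι : Type} [Fintype ι] [DecidableEq ι] (u : Cfg ι N → ℝ) (U : PSU ι N) (e : ι) :
    ∑ α : FrameIdx N, algD (bframe (e, α)) u (emb U) ^ 2 =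
      frobNorm (frameGrad ((fderiv ℝ u (emb U)).toLinearMap.comp
        ((LinearMap.single ℝ (fun _ : ι => Matrix (Fin N) (Fin N) ℂ) e).comp (LinearMap.mulRight ℝ ((U e : SUN N) : Matrix (Fin N) (Fin N) ℂ))))) ^ 2 := by
  set lam : Matrix (Fin N) (Fin N) ℂ →ₗ[ℝ] ℝ := (fderiv ℝ u (emb U)).toLinearMap.comp
    ((LinearMap.single ℝ (fun _ : ι => Matrix (Fin N) (Fin N) ℂ) e).comp (LinearMap.mulRight ℝ ((U e : SUN N) : Matrix (Fin N) (Fin N) ℂ))) with hlam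
  have hlam_apply : ∀ A, lam A = fderiv ℝ u (emb U) (Pi.single e (A * ((U e : SUN N) : Matrix (Fin N) (Fin N) ℂ))) := fun A => rfl
  rw [frobNorm_frameGrad_sq hN lam]
  have hUe : ((U e : SUN N) : Matrix (Fin N) (Fin N) ℂ) ∈ Matrix.unitaryGroup (Fin N) ℂ := (U e).2.1
  have h := SUNBakryEmery.sum_sq_apply_frame_mul_eq_sum_sq_apply_mul_frame hN
    ((fderiv ℝ u (emb U)).toLinearMap.comp (LinearMap.single ℝ (fun _ : ι => Matrix (Fin N) (Fin N) ℂ) e))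
    (Matrix.mem_unitaryGroup_iff.1 hUe) (Matrix.mem_unitaryGroup_iff'.1 hUe)
  have hlk : ∀ Y : Matrix (Fin N) (Fin N) ℂ, emb U * lk e Y = Pi.single e (((U e : SUN N) : Matrix (Fin N) (Fin N) ℂ) * Y) := by
    intro Y; funext e₂
    by_cases h : e₂ = e <;> [(subst h; simp [lk, emb]); simp [lk, Pi.single_eq_of_ne h]]
  simp only [LinearMap.coe_comp, Function.comp_apply, ContinuousLinearMap.coe_coe, LinearMap.single_apply] at h
  simp only [hlam_apply, algD_apply, bframe, hlk]
  exact h.symm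

/-- ★★ **The squared link gradient is dominated by the squared metric slope**, pointwise: for every smooth `u` of the link matrices, every
`U ∈ SU(N)^{E⁺(Λ_L)}` and every link `e`, `Σ_α (D_{(e,α)}u)²(U) ≤ (linkSlope (u∘emb) U e)²` — the Literature's derivative-free link slope
(`LatticeLangevinDynamics.linkSlope`, Frobenius chordal distance pulled back by the fundamental representation) dominates the Riemannian link
gradient of SZZ (3.7)–(3.8). [cite: ShenZhuZhu2022, §3 (3.8)] -/
theorem ofReal_linkGam_le_linkSlope_sq (hN : N ≠ 0) {u : Cfg (Edge d L) N → ℝ} (hu : ContDiff ℝ ∞ u) (U : GaugeConfig d L (SUN N)) (e : Edge d L) :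
    ENNReal.ofReal (∑ α : FrameIdx N, algD (bframe (e, α)) u (emb U) ^ 2) ≤
      linkSlope (fundamentalLatticeRep N) (fun V : GaugeConfig d L (SUN N) => u (emb V)) U e ^ 2 := by
  classical
  set M : Matrix (Fin N) (Fin N) ℂ := ((U e : SUN N) : Matrix (Fin N) (Fin N) ℂ) with hM
  set lam : Matrix (Fin N) (Fin N) ℂ →ₗ[ℝ] ℝ := (fderiv ℝ u (emb U)).toLinearMap.comp
    ((LinearMap.single ℝ (fun _ : Edge d L => Matrix (Fin N) (Fin N) ℂ) e).comp (LinearMap.mulRight ℝ M)) with hlam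
  have hlam_apply : ∀ A, lam A = fderiv ℝ u (emb U) (Pi.single e (A * M)) := fun A => rfl
  set Z : Matrix (Fin N) (Fin N) ℂ := frameGrad lam with hZdef
  have hZ : Zᴴ = -Z := frameGrad_conjTranspose lam
  have hZ0 : Z.trace = 0 := frameGrad_trace hN lam
  rw [sum_sq_algD_eq_frobNorm_frameGrad_sq hN u U e, ← hlam, ← hZdef]
  -- `lam Z = ‖Z‖²`
  have hlamZ : lam Z = frobNorm Z ^ 2 := by rw [hZdef, ← sum_sq_apply_frame, frobNorm_frameGrad_sq hN]
  by_cases hZ0' : frobNorm Z = 0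
  · rw [hZ0']; simp
  have hZpos : 0 < frobNorm Z := lt_of_le_of_ne (frobNorm_nonneg Z) (Ne.symm hZ0')
  have hMu : M ∈ Matrix.unitaryGroup (Fin N) ℂ := (U e).2.1
  -- the test curve `t ↦ e^{tZ} U_e` in `SU(N)` and the observable along it
  set g : ℝ → SUN N := fun t => expSU hZ hZ0 t * U e with hg
  have hgcoe : ∀ t, ((g t : SUN N) : Matrix (Fin N) (Fin N) ℂ) = NormedSpace.exp (t • Z) * M := fun t => rfl
  set F : GaugeConfig d L (SUN N) → ℝ := fun V => u (emb V) with hF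
  set c : ℝ → ℝ := fun t => u (Function.update (emb U) e (NormedSpace.exp (t • Z) * M)) with hc
  have hcF : ∀ t, F (Function.update U e (g t)) = c t := by
    intro t; simp only [hF, hc, emb_update, hgcoe]
  have hc0 : c 0 = F U := by
    have : Function.update (emb U) e (NormedSpace.exp ((0 : ℝ) • Z) * M) = emb U := by
      rw [zero_smul, NormedSpace.exp_zero, one_mul, hM]; exact Function.update_eq_self e (emb U)
    simp only [hc, hF, this]
  -- derivative of the curve of matrices and of `c` at `0`
  have hexp : HasDerivAt (fun t : ℝ => NormedSpace.exp (t • Z)) Z 0 := by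
    have h := hasDerivAt_exp_smul_const' (𝕂 := ℝ) Z (0 : ℝ)
    rwa [zero_smul, NormedSpace.exp_zero, mul_one] at h
  have hcurve : HasDerivAt (fun t : ℝ => Function.update (emb U) e (NormedSpace.exp (t • Z) * M))
      (Pi.single e (Z * M) : Cfg (Edge d L) N) 0 := by
    have h := (hasFDerivAt_update (emb U) (i := e) (NormedSpace.exp ((0 : ℝ) • Z) * M)).comp_hasDerivAt (0 : ℝ) (hexp.mul_const M)
    refine h.congr_deriv ?_
    funext i
    rw [ContinuousLinearMap.pi_apply]
    by_cases hi : i = e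
    · subst hi; simp
    · simp [hi]
  have hud : Differentiable ℝ u := hu.differentiable (by simp)
  have hcd : HasDerivAt c (lam Z) 0 := by
    have hbase : Function.update (emb U) e (NormedSpace.exp ((0 : ℝ) • Z) * M) = emb U := by
      rw [zero_smul, NormedSpace.exp_zero, one_mul, hM]; exact Function.update_eq_self e (emb U)
    have hu' : HasFDerivAt u (fderiv ℝ u (emb U)) (Function.update (emb U) e (NormedSpace.exp ((0 : ℝ) • Z) * M)) := by
      rw [hbase]; exact (hud _).hasFDerivAt
    have h := hu'.comp_hasDerivAt (0 : ℝ) hcurve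
    rw [hlam_apply]; exact h
  -- difference quotients: numerator and denominator
  have hnum : Tendsto (fun t : ℝ => t⁻¹ * (c t - c 0)) (𝓝[≠] 0) (𝓝 (frobNorm Z ^ 2)) := by
    have h := hcd.tendsto_slope_zero
    simp only [zero_add, smul_eq_mul, hlamZ] at h
    exact h
  have hden : Tendsto (fun t : ℝ => ‖t⁻¹ • (NormedSpace.exp (t • Z) - 1)‖) (𝓝[≠] 0) (𝓝 (frobNorm Z)) := by
    have h := hexp.tendsto_slope_zero
    simp only [zero_add, zero_smul, NormedSpace.exp_zero] at h
    rw [frobNorm_eq_norm]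
    exact h.norm
  -- the difference quotient of `F` along the curve tends to `‖Z‖`
  have hratio : Tendsto (fun t : ℝ => |F (Function.update U e (g t)) - F U| / frobNorm (((g t : SUN N) : Matrix (Fin N) (Fin N) ℂ) - M))
      (𝓝[≠] 0) (𝓝 (frobNorm Z)) := by
    have hlim : Tendsto (fun t : ℝ => |t⁻¹ * (c t - c 0)| / ‖t⁻¹ • (NormedSpace.exp (t • Z) - 1)‖) (𝓝[≠] 0) (𝓝 (frobNorm Z ^ 2 / frobNorm Z)) := by
      have h := hnum.abs.div hden hZ0'
      rw [abs_of_nonneg (sq_nonneg _)] at h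
      exact h
    rw [show frobNorm Z = frobNorm Z ^ 2 / frobNorm Z by rw [sq, mul_div_cancel_right₀ _ hZ0']]
    refine hlim.congr' (eventually_nhdsWithin_of_forall fun t ht => ?_)
    rw [Set.mem_compl_iff, Set.mem_singleton_iff] at ht
    symm
    show |F (Function.update U e (g t)) - F U| / frobNorm (((g t : SUN N) : Matrix (Fin N) (Fin N) ℂ) - M) = _
    rw [hcF, ← hc0, hgcoe, show NormedSpace.exp (t • Z) * M - M = (NormedSpace.exp (t • Z) - 1) * M by rw [sub_mul, one_mul],
      frobNorm_mul_unitary _ hMu, frobNorm_eq_norm, abs_mul, abs_inv, norm_smul, Real.norm_eq_abs, abs_inv,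
      mul_div_mul_left _ _ (inv_ne_zero (abs_ne_zero.2 ht))]
  -- the curve tends to `U_e` within the punctured neighbourhood
  have hgcont : Tendsto g (𝓝[≠] 0) (𝓝[≠] (U e)) := by
    refine tendsto_nhdsWithin_iff.2 ⟨?_, ?_⟩
    · have hcont : Continuous g := by
        have h1 : Continuous fun t : ℝ => expSU hZ hZ0 t :=
          (NormedSpace.exp_continuous.comp (continuous_id.smul continuous_const)).subtype_mk _
        exact h1.mul continuous_const
      have h0 : g 0 = U e := by
        apply Subtype.ext; rw [hgcoe, zero_smul, NormedSpace.exp_zero, one_mul]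
      rw [← h0]; exact hcont.continuousAt.tendsto.mono_left nhdsWithin_le_nhds
    · have hne : ∀ᶠ t : ℝ in 𝓝[≠] 0, t⁻¹ • (NormedSpace.exp (t • Z) - 1) ≠ 0 := by
        have h := hexp.tendsto_slope_zero
        simp only [zero_add, zero_smul, NormedSpace.exp_zero] at h
        refine h.eventually_ne ?_
        intro hZz; exact hZ0' (by rw [hZz, frobNorm_zero])
      refine hne.mono fun t ht => ?_
      rw [Set.mem_compl_iff, Set.mem_singleton_iff]
      intro hgt
      apply ht
      have h1 : NormedSpace.exp (t • Z) * M = M := by rw [← hgcoe, hgt]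
      have hMM : M * star M = 1 := Matrix.mem_unitaryGroup_iff.1 hMu
      have h2 : NormedSpace.exp (t • Z) = 1 := by
        calc NormedSpace.exp (t • Z) = NormedSpace.exp (t • Z) * (M * star M) := by rw [hMM, mul_one]
          _ = NormedSpace.exp (t • Z) * M * star M := by rw [mul_assoc]
          _ = M * star M := by rw [h1]
          _ = 1 := hMM
      rw [h2, sub_self, smul_zero]
  -- limsup along the curve ≤ limsup over the punctured neighbourhood
  have hφ : Tendsto (fun t : ℝ => ENNReal.ofReal (|F (Function.update U e (g t)) - F U| / frobNorm (((g t : SUN N) : Matrix (Fin N) (Fin N) ℂ) - M)))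
      (𝓝[≠] 0) (𝓝 (ENNReal.ofReal (frobNorm Z))) := ENNReal.tendsto_ofReal hratio
  have hls : ENNReal.ofReal (frobNorm Z) ≤ linkSlope (fundamentalLatticeRep N) F U e := by
    unfold linkSlope
    have hmap : Tendsto (fun g' : SUN N => ENNReal.ofReal (|F (Function.update U e g') - F U| /
        frobNorm ((fundamentalLatticeRep N).ρ g' - (fundamentalLatticeRep N).ρ (U e)))) (map g (𝓝[≠] 0)) (𝓝 (ENNReal.ofReal (frobNorm Z))) := by
      rw [tendsto_map'_iff]; exact hφ
    haveI : (map g (𝓝[≠] (0 : ℝ))).NeBot := Filter.map_neBot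
    rw [← hmap.limsup_eq]
    exact limsup_le_limsup_of_le hgcont
  calc ENNReal.ofReal (frobNorm Z ^ 2) = ENNReal.ofReal (frobNorm Z) ^ 2 := by rw [ENNReal.ofReal_pow (frobNorm_nonneg Z)]
    _ ≤ linkSlope (fundamentalLatticeRep N) F U e ^ 2 := pow_le_pow_left' hls 2

/-! ## §2. The Γ-integral is dominated by the Literature's Dirichlet form -/

/-- The lattice carré du champ is the sum over links of the squared link gradients. [cite: ShenZhuZhu2022, §3 (3.7)–(3.8)] -/
theorem Gam_self_eq_sum_sum_sq_algD {ι : Type} [Fintype ι] [DecidableEq ι] (u : Cfg ι N → ℝ) (Q : Cfg ι N) :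
    Gam u u Q = ∑ e : ι, ∑ α : FrameIdx N, algD (bframe (e, α)) u Q ^ 2 := by
  rw [Gam_self_eq_sum_linkFun]
  simp only [linkFun_apply, bframe]

/-- ★★ **`∫ Γ(u,u) dμ_{Λ_L,β'} ≤ 𝓔_{Λ_L,β'}(u∘emb)`**: the Dirichlet integral of the Bakry–Émery package is dominated by the Literature's derivative-free
Dirichlet form `langevinDirichletForm (fundamentalLatticeRep N) β'`, for every smooth `u` of the link matrices, every `SU(N)` (`N ≥ 1`), `d`, torus, `β'`.
[cite: ShenZhuZhu2022, §3 (3.8)] -/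
theorem ofReal_integral_Gam_le_langevinDirichletForm (hN : N ≠ 0) (β' : ℝ) {u : Cfg (Edge d L) N → ℝ} (hu : ContDiff ℝ ∞ u) :
    ENNReal.ofReal (∫ U, Gam u u (emb U) ∂(wilsonMeasure (d := d) (L := L) (fundamentalRep (Fin N)) β')) ≤
      langevinDirichletForm (fundamentalLatticeRep N) β' (fun V : GaugeConfig d L (SUN N) => u (emb V)) := by
  classical
  set μ := wilsonMeasure (d := d) (L := L) (fundamentalRep (Fin N)) β' with hμ
  haveI : IsProbabilityMeasure μ :=
    isProbabilityMeasure_wilsonMeasure (d := d) (L := L) (fundamentalRep (Fin N)) (continuous_fundamentalRep (n := Fin N)) β'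
  -- per-link gradient squares: continuous, nonnegative, integrable
  set G : Edge d L → GaugeConfig d L (SUN N) → ℝ := fun e U => ∑ α : FrameIdx N, algD (bframe (e, α)) u (emb U) ^ 2 with hG
  have hGc : ∀ e, Continuous (G e) := fun e => by
    refine continuous_finsetSum _ fun α _ => ?_
    exact ((Summit.Ventures.YMGap.LatticeBakryEmery.contDiff_algD hu _).continuous.comp
      Summit.Ventures.YMGap.LatticeBakryEmery.continuous_emb).pow 2
  have hG0 : ∀ e U, 0 ≤ G e U := fun e U => Finset.sum_nonneg fun α _ => sq_nonneg _
  have hGi : ∀ e, Integrable (G e) μ := fun e => (hGc e).integrable_of_hasCompactSupport (HasCompactSupport.of_compactSpace _)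
  have hsum : ∫ U, Gam u u (emb U) ∂μ = ∑ e, ∫ U, G e U ∂μ := by
    rw [← integral_finsetSum _ fun e _ => hGi e]
    refine integral_congr_ae (ae_of_all _ fun U => ?_)
    exact Gam_self_eq_sum_sum_sq_algD u (emb U)
  rw [hsum, ENNReal.ofReal_sum_of_nonneg fun e _ => integral_nonneg fun U => hG0 e U]
  unfold langevinDirichletForm
  refine Finset.sum_le_sum fun e _ => ?_
  rw [ofReal_integral_eq_lintegral_ofReal (hGi e) (ae_of_all _ fun U => hG0 e U)]
  refine lintegral_mono fun U => ?_
  exact ofReal_linkGam_le_linkSlope_sq hN hu U e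

/-! ## §3. The Poincaré inequality in the Dirichlet-form currency, every `SU(N)`, `d` -/

/-- ★★★ **Shen–Zhu–Zhu's Poincaré inequality (Cor. 4.4 (4.11)) in the currency of their Dirichlet form (3.8), derivative-free rendering, every `SU(N)`,
every `d`, every torus, every torus Hessian constant `Λ₀`**: for `K = N/2 − N|β|Λ₀ > 0` and every smooth `u` of the link matrices,
`K · Var_{μ_{Λ_L,Nβ}}(u) ≤ 𝓔_{Λ_L,Nβ}(u)` with `𝓔 = langevinDirichletForm (fundamentalLatticeRep N) (Nβ)` (metric link slopes).  The Yang–Mills mass gap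
is NOT proved. [cite: ShenZhuZhu2022, Corollary 4.4 (4.11)] -/
theorem szz_poincare_dirichletForm_of_hessBound_sun {Λ₀ : ℝ} (hH : WilsonHessianBound d N Λ₀) (hN : N ≠ 0) {β : ℝ}
    (hK : 0 < (N : ℝ) / 2 - N * |β| * Λ₀) {u : Cfg (Edge d L) N → ℝ} (hu : ContDiff ℝ ∞ u) :
    ENNReal.ofReal (((N : ℝ) / 2 - N * |β| * Λ₀) *
        Var[fun U : GaugeConfig d L (SUN N) => u (emb U); wilsonMeasure (d := d) (L := L) (fundamentalRep (Fin N)) ((N : ℝ) * β)]) ≤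
      langevinDirichletForm (fundamentalLatticeRep N) ((N : ℝ) * β) (fun V : GaugeConfig d L (SUN N) => u (emb V)) := by
  have h := torus_variance_le_integral_Gam_sun (L := L) hH hN β hK hu
  rw [le_div_iff₀ hK, mul_comm] at h
  exact (ENNReal.ofReal_le_ofReal h).trans (ofReal_integral_Gam_le_langevinDirichletForm (L := L) hN _ hu)

/-- ★★★ **Sharp window, every `SU(N)`, `d`**: for `|β| < 1/(8d)` (`K = N/2 − 4dN|β| > 0`),
`K · Var_{μ_{Λ_L,Nβ}}(u) ≤ langevinDirichletForm (fundamentalLatticeRep N) (Nβ) u` for every smooth `u` of the link matrices on every torus.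
The Yang–Mills mass gap is NOT proved. [cite: ShenZhuZhu2022, Corollary 4.4 (4.11)] -/
theorem szz_poincare_dirichletForm_sun (hN : N ≠ 0) {β : ℝ} (hK : 0 < (N : ℝ) / 2 - N * |β| * (4 * d)) {u : Cfg (Edge d L) N → ℝ}
    (hu : ContDiff ℝ ∞ u) :
    ENNReal.ofReal (((N : ℝ) / 2 - N * |β| * (4 * d)) *
        Var[fun U : GaugeConfig d L (SUN N) => u (emb U); wilsonMeasure (d := d) (L := L) (fundamentalRep (Fin N)) ((N : ℝ) * β)]) ≤
      langevinDirichletForm (fundamentalLatticeRep N) ((N : ℝ) * β) (fun V : GaugeConfig d L (SUN N) => u (emb V)) :=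
  szz_poincare_dirichletForm_of_hessBound_sun (Summit.Ventures.YMGap.HessianSharp.wilsonHessianBound_four_d d N) hN hK hu

/-- ★★★ **Shen–Zhu–Zhu, Corollary 4.4 (4.11), Poincaré half, AS PRINTED in the currency of the Dirichlet form (3.8)**, every `SU(N)`, every `d ≥ 2`,
every torus: under Assumption 1.1 (`|β| < 1/(16(d−1))`, `K_S = szzBakryEmeryConstSU N d β > 0`), for every smooth `u` of the link matrices,
`K_S · Var_{μ_{Λ_L,N,β}}(u) ≤ 𝓔_{Λ_L}(u)`, `𝓔 = langevinDirichletForm (fundamentalLatticeRep N) (Nβ)`.  HONEST FRAMING: strong coupling, lattice.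
[cite: ShenZhuZhu2022, Corollary 4.4 (4.11)] -/
theorem szz_poincare_dirichletForm_printed_sun (hd : 2 ≤ d) (hN : 1 ≤ N) {β : ℝ} (hβ : |β| < szzThresholdSU d) {u : Cfg (Edge d L) N → ℝ}
    (hu : ContDiff ℝ ∞ u) :
    ENNReal.ofReal (szzBakryEmeryConstSU N d β *
        Var[fun U : GaugeConfig d L (SUN N) => u (emb U); wilsonMeasure (d := d) (L := L) (fundamentalRep (Fin N)) ((N : ℝ) * β)]) ≤
      langevinDirichletForm (fundamentalLatticeRep N) ((N : ℝ) * β) (fun V : GaugeConfig d L (SUN N) => u (emb V)) := by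
  have hKS : 0 < szzBakryEmeryConstSU N d β := (szzBakryEmeryConstSU_pos_iff hd hN β).2 hβ
  have hle := szzBakryEmeryConstSU_le_sharp hd N β
  have hK : 0 < (N : ℝ) / 2 - N * |β| * (4 * d) := hKS.trans_le hle
  have hN0 : N ≠ 0 := by omega
  refine le_trans (ENNReal.ofReal_le_ofReal ?_) (szz_poincare_dirichletForm_sun (L := L) hN0 hK hu)
  haveI : IsProbabilityMeasure (wilsonMeasure (d := d) (L := L) (fundamentalRep (Fin N)) ((N : ℝ) * β)) :=
    isProbabilityMeasure_wilsonMeasure (d := d) (L := L) (fundamentalRep (Fin N)) (continuous_fundamentalRep (n := Fin N)) _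
  exact mul_le_mul_of_nonneg_right hle (variance_nonneg _ _)

end Summit.QuantumFields.YangMills.Theorems.ColdStartUniversality

end
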